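import Summits.HodgeConjecture.HodgeConjecture.Theorems.F0P3cStCharTSHaarPsi      -- ★ p850102 HAAR-PSI: `card_mul_measure_eq_map_of_preimage_cover`, `exists_map_eq_smul_of_isHaarMeasure`, `exists_torusIso`
import Summits.HodgeConjecture.HodgeConjecture.Theorems.F0P3cStCharTSConstants    -- ★ p850071 CONSTANTS: Haar positivity on compact opens (`measureReal_coe_subgroup_pos`, …)
import Literature.NumberTheory.Rogawski1990.UnitFundamentalLemmaInertResiduallyRegularExplicit   -- ★ `endoEmbLocal_mem_cmLocalIntegralLevel_of_nonsplit`, `endoGL_mem_glInt` (UNIT-SET-Ψ, «⊇»)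
import Literature.NumberTheory.Automorphic.UnitOrbitalIntegralFixedPointsPair                    -- ★ `cmLocalIntegralLevel_one_eq_top_of_smul_eq` (`U(Φ₁)(L⁺_v) = U(Φ₁)(𝒪_v)` at non-split `v`)
import HarnessLib

/-!
# F0 · P3c · line LH6 «StCharTS» — road (D) «DEEP-FL», brick «HCARD★»: the Haar count `#F · r_G = r_H` and `r_H ≠ 0` of the VALUE third of the
# XIG-ASSEMBLY head, with «UNIT-SET-Ψ» `Ψ_T⁻¹(T₃ ∩ K_v) = (T₂ ∩ K_{2,v}) × U(Φ₁)_v` proved in-file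

Cell `pub/hodgecm-mathlib`, crux H413 = `stmt-HodgeConjecture-24833` (lane `--supports … --as helper`), route HCCMUnconditional; hand LH5-p01 (g2) on the road-(D)
owner's deal (LH6-p04 (g3), 2026-09-02T07:27:54Z «TAKE HCARD★»); letters = LH6-p02 (g2)'s KAPPA-RATIO sheet v1 (c727433790841ad4) §1 (RG)(RH)(CNT), ruled «letters of
record» by the owner 07:32:36Z.  THEOREMS ONLY, sorry-free, ★-only imports; no definition ∕ instance ∕ notation ∕ named fact.  HONEST LABEL: HC_CM is proved only modulo
the 7 printed citations (2 remaining: hLiu418 = stmt-HodgeConjecture-24832, h413 = stmt-HodgeConjecture-24833) until rung 0 closes; count-neutral plumbing of road (D).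

THE MATHEMATICS ([Rogawski1990, §4.9 Lemma 4.9.2 p. 56; §12.7 L. 12.7.3 (proof) p. 195]).  The VALUE third ★ `steinbergLabel_smoothTrace_sum_eq_cmXiTorusChar` (p850018) and ★
CJ-BLOCK (p850160) carry two free scalars `rG`, `rH` with the constraints `κG·κ = AG·rG`, `κH u = A u·rH` (KAPPA-RATIO) and the COUNT `#F·rG = rH`, `rH ≠ 0` (this file).
With the letters of record `rG = μ_T(T₃ ∩ K_v) ∕ μ_T(S_n)` (★ HOG-OF-GVALUE p850178's ratio) and `rH = ν₁(U(Φ₁)_v)·μ_{T₂}(T₂ ∩ K_{2,v}) ∕ (ν₁(K₁)·μ_{T₂}(C₂))` (★ HOH-SHELL-H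
②'s ratio over ★ ST-SHELL-TRACE's constant), the count is pure Haar bookkeeping along the torus isomorphism `Ψ_T : T₂ × U(Φ₁)_v ≃ₜ* T₃` (★ HAAR-PSI `exists_torusIso`):
`(Ψ_T)_*(μ_{T₂} ⊗ ν₁) = c • μ_T` for one `c > 0` (Haar uniqueness), the coset cover `Ψ₀⁻¹(b′·S_n) = ⨆_{u ∈ F} u·S′` of ★ XIG-DATA gives `#F·μ_{T₂}(C₂)ν₁(K₁) = c·μ_T(S_n)`
(★ HAAR-PSI), and «UNIT-SET-Ψ» `Ψ_T⁻¹(T₃ ∩ K_v) = (T₂ ∩ K_{2,v}) × U(Φ₁)_v` gives `μ_{T₂}(T₂ ∩ K_{2,v})·ν₁(U(Φ₁)_v) = c·μ_T(T₃ ∩ K_v)`; dividing kills `c`.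

* §1 (generic, `e : X ≃ₜ* T`, Haar `μ_H`, `μ_T`) `card_mul_div_eq_div_of_preimage_cover(_complex)`: `#F · (μ_T(K) ∕ μ_T(S_n)) = μ_H(e⁻¹K) ∕ μ_H(S′)`.
* §2 (CM) `card_mul_rG_eq_preimage_form` (no unit-set input), `hcard_of_unitSet` (letters of record, unit set BY SHAPE), `rH_preimage_form_ne_zero`,
  `hrH_of_unitSet` (`ν₁(U(Φ₁)_v) < ∞` is OUTPUT: `Ψ_T⁻¹` of the compact `T₃ ∩ K_v`).
* §3 «UNIT-SET-Ψ» `mem_glInt_of_endoGL_mem_glInt` (converse of ★ `endoGL_mem_glInt` on the corner block), `endoEmbLocal_mem_cmLocalIntegralLevel_iff_of_nonsplit`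
  (`ι_v(γ₂, γ₁) ∈ K_v ↔ γ₂ ∈ K_{2,v}` at a non-split place; ★ `endoEmbLocal_mem_cmLocalIntegralLevel_of_nonsplit` + ★ `mem_localIntegralLevel_iff_of_smul_eq` + ★ `map_endoGL`),
  `preimage_torusIso_unitSet`.
* §4 **`hcard`**, **`hrH`** — the two binders of ★ p850018 in the letters of record, hypothesis-free at a non-split place `(w) (hw)`.

## References
* [Rogawski1990] J. D. Rogawski, *Automorphic Representations of Unitary Groups in Three Variables*, Ann. of Math. Stud. 123 (1990): §4.9 Lemma 4.9.2 p. 56, §4.9 p. 54;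
  §12.7 Lemma 12.7.3 (proof) p. 195; §1.7 p. 6.
* [DeitmarEchterhoff2014] A. Deitmar, S. Echterhoff, *Principles of Harmonic Analysis*, 2nd ed. (2014), Thm. 1.5.3 (uniqueness of Haar measure).
* [HewittRoss1979] E. Hewitt, K. A. Ross, *Abstract Harmonic Analysis I*, 2nd ed. (1979), (15.8).
* [PlatonovRapinchuk1994] V. Platonov, A. Rapinchuk, *Algebraic Groups and Number Theory* (1994), §5.1.
-/

set_option autoImplicit false
set_option linter.dupNamespace false

noncomputable section

open MeasureTheory Measure Set Filter Topology Function NumberField IsDedekindDomain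
open Literature.NumberTheory.Automorphic Literature.NumberTheory.Automorphic.UnitaryGroup Literature.NumberTheory.Rogawski1990
open Summit.HodgeConjecture.HodgeConjecture.Cruxes.H413.F0P3cStCharTSHaarPsi
open Literature.NumberTheory.GaloisRepresentations
open scoped ENNReal NNReal MatrixGroups Pointwise ValuativeRel

namespace Summit.HodgeConjecture.HodgeConjecture.Cruxes.H413.F0P3cStCharTSHcard

/-! ## §1 Generic: the count ratio along a torus isomorphism -/

section Generic

variable {X T : Type*} [Group X] [Group T] [TopologicalSpace X] [TopologicalSpace T]
  [IsTopologicalGroup T] [MeasurableSpace X] [BorelSpace X] [IsTopologicalGroup X] [MeasurableSpace T] [BorelSpace T]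

/-- **THE COUNT RATIO.**  `e : X ≃ₜ* T` an isomorphism of topological groups, `μ_H`, `μ_T` Haar measures on `X`, `T`; if `e⁻¹(b′ • S_n) = ⋃_{u ∈ F} u • S′`
with the cosets pairwise disjoint, `0 < μ_H(S′) < ∞`, `0 < μ_T(S_n) < ∞`, then for every measurable `K ⊆ T`:
`#F · (μ_T(K) ∕ μ_T(S_n)) = μ_H(e⁻¹ K) ∕ μ_H(S′)` — the Haar constant `c` of `e_* μ_H = c • μ_T` cancels between the count
`#F · μ_H(S′) = c · μ_T(S_n)` (★ `card_mul_measure_eq_map_of_preimage_cover`) and `μ_H(e⁻¹ K) = c · μ_T(K)`.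
[cite: Rogawski1990, §4.9 Lemma 4.9.2 p. 56; §12.7 L. 12.7.3 (proof) p. 195] [cite: DeitmarEchterhoff2014, Thm. 1.5.3] -/
theorem card_mul_div_eq_div_of_preimage_cover [LocallyCompactSpace T] [SecondCountableTopology T] (e : X ≃ₜ* T)
    (μH : Measure X) [μH.IsHaarMeasure] (μT : Measure T) [μT.IsHaarMeasure]
    {ι : Type*} (F : Finset ι) (u : ι → X) (S' : Set X) (hS' : MeasurableSet S') (hS'0 : μH S' ≠ 0) (hS'top : μH S' ≠ ∞)
    (Sn : Set T) (hSn : MeasurableSet Sn) (hSn0 : μT Sn ≠ 0) (hSntop : μT Sn ≠ ∞) (b' : T)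
    (hcover : e ⁻¹' (b' • Sn) = ⋃ j ∈ F, u j • S') (hdisj : (F : Set ι).PairwiseDisjoint fun j => u j • S')
    (K : Set T) (hK : MeasurableSet K) :
    (F.card : ℝ) * (μT.real K / μT.real Sn) = μH.real (e ⁻¹' K) / μH.real S' := by
  obtain ⟨c, hc0, hce⟩ := exists_map_eq_smul_of_isHaarMeasure e μH μT
  have h1 := card_mul_measure_eq_map_of_preimage_cover e μH F u S' hS' Sn hSn b' hcover hdisj
  rw [hce, Measure.coe_nnreal_smul_apply] at h1
  have h2 : μH (e ⁻¹' K) = (c : ℝ≥0∞) * μT K := by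
    rw [← Measure.map_apply (map_continuous e).measurable hK, hce, Measure.coe_nnreal_smul_apply]
  -- pass to real numbers
  have h1r : (F.card : ℝ) * μH.real S' = (c : ℝ) * μT.real Sn := by
    have := congrArg ENNReal.toReal h1
    simpa only [ENNReal.toReal_mul, ENNReal.toReal_natCast, ENNReal.coe_toReal, measureReal_def] using this
  have h2r : μH.real (e ⁻¹' K) = (c : ℝ) * μT.real K := by
    rw [measureReal_def, h2, ENNReal.toReal_mul, ENNReal.coe_toReal, measureReal_def]
  have hS'r : μH.real S' ≠ 0 := (measureReal_ne_zero_iff hS'top).2 hS'0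
  have hSnr : μT.real Sn ≠ 0 := (measureReal_ne_zero_iff hSntop).2 hSn0
  rw [h2r, mul_div_assoc', div_eq_div_iff hSnr hS'r]
  calc (F.card : ℝ) * μT.real K * μH.real S' = ((F.card : ℝ) * μH.real S') * μT.real K := by ring
    _ = (c : ℝ) * μT.real Sn * μT.real K := by rw [h1r]
    _ = (c : ℝ) * μT.real K * μT.real Sn := by ring

end Generic

/-! ## §2 The CM tori: `#F · r_G = r_H` and `r_H ≠ 0` for the VALUE third of the XIG-ASSEMBLY head -/

section CM

variable (L : Type) [Field L] [NumberField L] [IsCMField L] (v : HeightOneSpectrum (𝓞 ↥(maximalRealSubfield L)))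

set_option maxHeartbeats 4000000 in  -- cross-spelling `whnf` `(cmDatum L N Φ_N).Local v` ≡ `↥(unitaryGroupOfForm … (cmLocalForm L N v))` in `↑t ∈ K_v` (measured class, as ★ CONSTANTS)
set_option synthInstance.maxHeartbeats 400000 in
/-- **«HCARD★» — the Haar count of the VALUE third, `Ψ⁻¹`-form.**  For the torus isomorphism `Ψ_T : T_H = T₂ × U(Φ₁)_v ≃ₜ* T₃` (★ `exists_torusIso`), Haar measures
`μ_T` on `T₃`, `μ_{T₂}` on `T₂`, `ν₁` on `U(Φ₁)_v`, the XIG-DATA cover (`S_n ≤ T₃` compact open, `b′`, `S′ = C₂ × K₁` with `C₂ ≤ T₂`, `K₁ ≤ U(Φ₁)_v` compact open, `F` finite,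
`Ψ₀⁻¹(val '' (b′ • S_n)) = ⋃_{u ∈ F} u • S′`, cosets pairwise disjoint):
`#F · (μ_T{t ∈ K_v} ∕ μ_T(S_n)) = (μ_{T₂} ⊗ ν₁)(Ψ_T⁻¹{t ∈ K_v}) ∕ (μ_{T₂}(C₂) · ν₁(K₁))` — the Haar constant of `(Ψ_T)_*(μ_{T₂} ⊗ ν₁) = c • μ_T` cancels
(§1). [cite: Rogawski1990, §4.9 Lemma 4.9.2 p. 56; §12.7 L. 12.7.3 (proof) p. 195] [cite: DeitmarEchterhoff2014, Thm. 1.5.3] -/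
theorem card_mul_rG_eq_preimage_form
    [MeasurableSpace ↥(unitaryGroupOfForm (conjLocal L (IsCMField.complexConj L) v) (cmLocalForm L 2 v))] [BorelSpace ↥(unitaryGroupOfForm (conjLocal L (IsCMField.complexConj L) v) (cmLocalForm L 2 v))] [MeasurableSpace ((cmDatum L 1 (Matrix.of fun i j : Fin 1 => if i.val + j.val + 1 = 1 then (1 : L) else 0)).Local v)] [BorelSpace ((cmDatum L 1 (Matrix.of fun i j : Fin 1 => if i.val + j.val + 1 = 1 then (1 : L) else 0)).Local v)] [MeasurableSpace ↥(unitaryGroupOfForm (conjLocal L (IsCMField.complexConj L) v) (cmLocalForm L 3 v))] [BorelSpace ↥(unitaryGroupOfForm (conjLocal L (IsCMField.complexConj L) v) (cmLocalForm L 3 v))]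
    (Ψ : (↥(cmBorelTriple L 2 v).M × ((cmDatum L 1 (Matrix.of fun i j : Fin 1 => if i.val + j.val + 1 = 1 then (1 : L) else 0)).Local v)) ≃ₜ* ↥(cmBorelTriple L 3 v).M)
    (hΨ : ∀ x : (↥(cmBorelTriple L 2 v).M × ((cmDatum L 1 (Matrix.of fun i j : Fin 1 => if i.val + j.val + 1 = 1 then (1 : L) else 0)).Local v)), (((Ψ x : ↥(cmBorelTriple L 3 v).M)) : ↥(unitaryGroupOfForm (conjLocal L (IsCMField.complexConj L) v) (cmLocalForm L 3 v))) = endoEmbLocal L v ((x.1 : ↥(unitaryGroupOfForm (conjLocal L (IsCMField.complexConj L) v) (cmLocalForm L 2 v))), x.2))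
    (μT : Measure ↥(cmBorelTriple L 3 v).M) [μT.IsHaarMeasure] (μT₂ : Measure ↥(cmBorelTriple L 2 v).M) [μT₂.IsHaarMeasure] (ν₁ : Measure ((cmDatum L 1 (Matrix.of fun i j : Fin 1 => if i.val + j.val + 1 = 1 then (1 : L) else 0)).Local v)) [ν₁.IsHaarMeasure]
    (Sn : Subgroup ↥(cmBorelTriple L 3 v).M) (hSnc : IsCompact (Sn : Set ↥(cmBorelTriple L 3 v).M)) (hSno : IsOpen (Sn : Set ↥(cmBorelTriple L 3 v).M)) (b' : ↥(cmBorelTriple L 3 v).M)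
    (C₂ : Subgroup ↥(cmBorelTriple L 2 v).M) (hC₂o : IsOpen (C₂ : Set ↥(cmBorelTriple L 2 v).M)) (hC₂c : IsCompact (C₂ : Set ↥(cmBorelTriple L 2 v).M))
    (K₁ : Subgroup ((cmDatum L 1 (Matrix.of fun i j : Fin 1 => if i.val + j.val + 1 = 1 then (1 : L) else 0)).Local v)) (hK₁o : IsOpen (K₁ : Set ((cmDatum L 1 (Matrix.of fun i j : Fin 1 => if i.val + j.val + 1 = 1 then (1 : L) else 0)).Local v))) (hK₁c : IsCompact (K₁ : Set ((cmDatum L 1 (Matrix.of fun i j : Fin 1 => if i.val + j.val + 1 = 1 then (1 : L) else 0)).Local v)))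
    (F : Finset (↥(cmBorelTriple L 2 v).M × ((cmDatum L 1 (Matrix.of fun i j : Fin 1 => if i.val + j.val + 1 = 1 then (1 : L) else 0)).Local v)))
    (hcover : (fun x : (↥(cmBorelTriple L 2 v).M × ((cmDatum L 1 (Matrix.of fun i j : Fin 1 => if i.val + j.val + 1 = 1 then (1 : L) else 0)).Local v)) => endoEmbLocal L v ((x.1 : ↥(unitaryGroupOfForm (conjLocal L (IsCMField.complexConj L) v) (cmLocalForm L 2 v))), x.2)) ⁻¹' (Subtype.val '' (b' • (Sn : Set ↥(cmBorelTriple L 3 v).M))) = ⋃ u ∈ F, u • ((C₂.prod K₁ : Subgroup (↥(cmBorelTriple L 2 v).M × ((cmDatum L 1 (Matrix.of fun i j : Fin 1 => if i.val + j.val + 1 = 1 then (1 : L) else 0)).Local v))) : Set (↥(cmBorelTriple L 2 v).M × ((cmDatum L 1 (Matrix.of fun i j : Fin 1 => if i.val + j.val + 1 = 1 then (1 : L) else 0)).Local v))))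
    (hdisj : (↑F : Set (↥(cmBorelTriple L 2 v).M × ((cmDatum L 1 (Matrix.of fun i j : Fin 1 => if i.val + j.val + 1 = 1 then (1 : L) else 0)).Local v))).PairwiseDisjoint (fun u => u • ((C₂.prod K₁ : Subgroup (↥(cmBorelTriple L 2 v).M × ((cmDatum L 1 (Matrix.of fun i j : Fin 1 => if i.val + j.val + 1 = 1 then (1 : L) else 0)).Local v))) : Set (↥(cmBorelTriple L 2 v).M × ((cmDatum L 1 (Matrix.of fun i j : Fin 1 => if i.val + j.val + 1 = 1 then (1 : L) else 0)).Local v))))) :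
    (F.card : ℂ) * (((μT.real {t : ↥(cmBorelTriple L 3 v).M | (t : ↥(unitaryGroupOfForm (conjLocal L (IsCMField.complexConj L) v) (cmLocalForm L 3 v))) ∈ cmLocalIntegralLevel L 3 (Matrix.of fun i j : Fin 3 => if i.val + j.val + 1 = 3 then (1 : L) else 0) v} : ℝ) : ℂ) / ((μT.real (Sn : Set ↥(cmBorelTriple L 3 v).M) : ℝ) : ℂ)) =
      (((μT₂.prod ν₁).real (Ψ ⁻¹' {t : ↥(cmBorelTriple L 3 v).M | (t : ↥(unitaryGroupOfForm (conjLocal L (IsCMField.complexConj L) v) (cmLocalForm L 3 v))) ∈ cmLocalIntegralLevel L 3 (Matrix.of fun i j : Fin 3 => if i.val + j.val + 1 = 3 then (1 : L) else 0) v}) : ℝ) : ℂ) /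
        ((μT₂.real (C₂ : Set ↥(cmBorelTriple L 2 v).M) * ν₁.real (K₁ : Set ((cmDatum L 1 (Matrix.of fun i j : Fin 1 => if i.val + j.val + 1 = 1 then (1 : L) else 0)).Local v)) : ℝ) : ℂ) := by
  haveI : SecondCountableTopology ↥(unitaryGroupOfForm (conjLocal L (IsCMField.complexConj L) v) (cmLocalForm L 2 v)) := secondCountableTopology_local (IsCMField.complexConj L) 2 _ v
  haveI : SecondCountableTopology ((cmDatum L 1 (Matrix.of fun i j : Fin 1 => if i.val + j.val + 1 = 1 then (1 : L) else 0)).Local v) := secondCountableTopology_local (IsCMField.complexConj L) 1 _ v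
  haveI : SecondCountableTopology ↥(unitaryGroupOfForm (conjLocal L (IsCMField.complexConj L) v) (cmLocalForm L 3 v)) := secondCountableTopology_local (IsCMField.complexConj L) 3 _ v
  haveI : SecondCountableTopology ↥(cmBorelTriple L 2 v).M := TopologicalSpace.Subtype.secondCountableTopology _
  haveI : SecondCountableTopology ↥(cmBorelTriple L 3 v).M := TopologicalSpace.Subtype.secondCountableTopology _
  haveI : LocallyCompactSpace ↥(unitaryGroupOfForm (conjLocal L (IsCMField.complexConj L) v) (cmLocalForm L 3 v)) := locallyCompactSpace_local (IsCMField.complexConj L) 3 _ v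
  haveI : LocallyCompactSpace ↥(cmBorelTriple L 3 v).M := (isClosed_cmBorelTriple_M L v).isClosedEmbedding_subtypeVal.locallyCompactSpace
  haveI : LocallyCompactSpace ↥(unitaryGroupOfForm (conjLocal L (IsCMField.complexConj L) v) (cmLocalForm L 2 v)) := locallyCompactSpace_local (IsCMField.complexConj L) 2 _ v
  haveI : T2Space ↥(unitaryGroupOfForm (conjLocal L (IsCMField.complexConj L) v) (cmLocalForm L 2 v)) := t2Space_cmDatum_local 2 L (Matrix.of fun i j : Fin 2 => if i.val + j.val + 1 = 2 then (1 : L) else 0) v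
  haveI : T1Space (LocalRing L v) := inferInstance
  have hTcl := isClosed_torusU_of_t1Space (conjLocal L (IsCMField.complexConj L) v) (cmLocalForm L 2 v)
  haveI : LocallyCompactSpace ↥(cmBorelTriple L 2 v).M := hTcl.isClosedEmbedding_subtypeVal.locallyCompactSpace
  haveI : SigmaCompactSpace ↥(cmBorelTriple L 2 v).M := sigmaCompactSpace_of_locallyCompact_secondCountable
  haveI : LocallyCompactSpace ((cmDatum L 1 (Matrix.of fun i j : Fin 1 => if i.val + j.val + 1 = 1 then (1 : L) else 0)).Local v) := locallyCompactSpace_local (IsCMField.complexConj L) 1 _ v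
  haveI : SigmaCompactSpace ((cmDatum L 1 (Matrix.of fun i j : Fin 1 => if i.val + j.val + 1 = 1 then (1 : L) else 0)).Local v) := sigmaCompactSpace_of_locallyCompact_secondCountable
  haveI : BorelSpace (↥(cmBorelTriple L 2 v).M × ((cmDatum L 1 (Matrix.of fun i j : Fin 1 => if i.val + j.val + 1 = 1 then (1 : L) else 0)).Local v)) := Prod.borelSpace
  -- the cover read through `Ψ`
  have hpre : Ψ ⁻¹' (b' • (Sn : Set ↥(cmBorelTriple L 3 v).M)) = ⋃ u ∈ F, (fun u => u) u • ((C₂.prod K₁ : Subgroup (↥(cmBorelTriple L 2 v).M × ((cmDatum L 1 (Matrix.of fun i j : Fin 1 => if i.val + j.val + 1 = 1 then (1 : L) else 0)).Local v))) : Set (↥(cmBorelTriple L 2 v).M × ((cmDatum L 1 (Matrix.of fun i j : Fin 1 => if i.val + j.val + 1 = 1 then (1 : L) else 0)).Local v))) := by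
    rw [← hcover]
    ext x
    rw [mem_preimage, mem_preimage, ← hΨ x, Subtype.val_injective.mem_set_image]
    exact Iff.rfl
  -- measurability ∕ positivity ∕ finiteness of the three sets
  have hKco := isCompact_isOpen_cmLocalIntegralLevel L 3 (Matrix.of fun i j : Fin 3 => if i.val + j.val + 1 = 3 then (1 : L) else 0) v
  have hKvo : IsOpen {t : ↥(cmBorelTriple L 3 v).M | (t : ↥(unitaryGroupOfForm (conjLocal L (IsCMField.complexConj L) v) (cmLocalForm L 3 v))) ∈ cmLocalIntegralLevel L 3 (Matrix.of fun i j : Fin 3 => if i.val + j.val + 1 = 3 then (1 : L) else 0) v} := hKco.2.preimage continuous_subtype_val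
  have hS'eq : ((C₂.prod K₁ : Subgroup (↥(cmBorelTriple L 2 v).M × ((cmDatum L 1 (Matrix.of fun i j : Fin 1 => if i.val + j.val + 1 = 1 then (1 : L) else 0)).Local v))) : Set (↥(cmBorelTriple L 2 v).M × ((cmDatum L 1 (Matrix.of fun i j : Fin 1 => if i.val + j.val + 1 = 1 then (1 : L) else 0)).Local v))) = (C₂ : Set ↥(cmBorelTriple L 2 v).M) ×ˢ (K₁ : Set ((cmDatum L 1 (Matrix.of fun i j : Fin 1 => if i.val + j.val + 1 = 1 then (1 : L) else 0)).Local v)) := Subgroup.coe_prod _ _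
  have hS'o : IsOpen ((C₂.prod K₁ : Subgroup (↥(cmBorelTriple L 2 v).M × ((cmDatum L 1 (Matrix.of fun i j : Fin 1 => if i.val + j.val + 1 = 1 then (1 : L) else 0)).Local v))) : Set (↥(cmBorelTriple L 2 v).M × ((cmDatum L 1 (Matrix.of fun i j : Fin 1 => if i.val + j.val + 1 = 1 then (1 : L) else 0)).Local v))) := by rw [hS'eq]; exact hC₂o.prod hK₁o
  have hS'c : IsCompact ((C₂.prod K₁ : Subgroup (↥(cmBorelTriple L 2 v).M × ((cmDatum L 1 (Matrix.of fun i j : Fin 1 => if i.val + j.val + 1 = 1 then (1 : L) else 0)).Local v))) : Set (↥(cmBorelTriple L 2 v).M × ((cmDatum L 1 (Matrix.of fun i j : Fin 1 => if i.val + j.val + 1 = 1 then (1 : L) else 0)).Local v))) := by rw [hS'eq]; exact hC₂c.prod hK₁c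
  have hS'0 : (μT₂.prod ν₁) ((C₂.prod K₁ : Subgroup (↥(cmBorelTriple L 2 v).M × ((cmDatum L 1 (Matrix.of fun i j : Fin 1 => if i.val + j.val + 1 = 1 then (1 : L) else 0)).Local v))) : Set (↥(cmBorelTriple L 2 v).M × ((cmDatum L 1 (Matrix.of fun i j : Fin 1 => if i.val + j.val + 1 = 1 then (1 : L) else 0)).Local v))) ≠ 0 := hS'o.measure_ne_zero _ ⟨1, Subgroup.one_mem _⟩
  have hS'top : (μT₂.prod ν₁) ((C₂.prod K₁ : Subgroup (↥(cmBorelTriple L 2 v).M × ((cmDatum L 1 (Matrix.of fun i j : Fin 1 => if i.val + j.val + 1 = 1 then (1 : L) else 0)).Local v))) : Set (↥(cmBorelTriple L 2 v).M × ((cmDatum L 1 (Matrix.of fun i j : Fin 1 => if i.val + j.val + 1 = 1 then (1 : L) else 0)).Local v))) ≠ ∞ := hS'c.measure_lt_top.ne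
  have hSn0 : μT (Sn : Set ↥(cmBorelTriple L 3 v).M) ≠ 0 := hSno.measure_ne_zero _ ⟨1, Subgroup.one_mem _⟩
  have hSntop : μT (Sn : Set ↥(cmBorelTriple L 3 v).M) ≠ ∞ := hSnc.measure_lt_top.ne
  have h := card_mul_div_eq_div_of_preimage_cover Ψ (μT₂.prod ν₁) μT F (fun u => u) _ hS'o.measurableSet hS'0 hS'top
    (Sn : Set ↥(cmBorelTriple L 3 v).M) hSnc.isClosed.measurableSet hSn0 hSntop b' hpre hdisj _ hKvo.measurableSet
  rw [hS'eq, measureReal_prod_prod] at h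
  have h' := congrArg (fun r : ℝ => (r : ℂ)) h
  simpa only [Complex.ofReal_mul, Complex.ofReal_natCast, Complex.ofReal_div] using h'

set_option maxHeartbeats 4000000 in  -- cross-spelling `whnf` (as above)
set_option synthInstance.maxHeartbeats 400000 in
/-- **`r_H ≠ 0` (`Ψ⁻¹`-form)**: `(μ_{T₂} ⊗ ν₁)(Ψ_T⁻¹{t ∈ K_v}) ∕ (μ_{T₂}(C₂) · ν₁(K₁)) ≠ 0` — `Ψ_T⁻¹{t ∈ K_v}` is a compact open neighbourhood of `1` (`K_v` compact open, `T₃` closed,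
`Ψ_T` a homeomorphism), `C₂ × K₁` likewise; Haar measures of non-empty compact open sets are positive reals. [cite: HewittRoss1979, (15.8)] [cite: Rogawski1990, §12.7 L. 12.7.3 (proof) p. 195] -/
theorem rH_preimage_form_ne_zero
    [MeasurableSpace ↥(unitaryGroupOfForm (conjLocal L (IsCMField.complexConj L) v) (cmLocalForm L 2 v))] [BorelSpace ↥(unitaryGroupOfForm (conjLocal L (IsCMField.complexConj L) v) (cmLocalForm L 2 v))] [MeasurableSpace ((cmDatum L 1 (Matrix.of fun i j : Fin 1 => if i.val + j.val + 1 = 1 then (1 : L) else 0)).Local v)] [BorelSpace ((cmDatum L 1 (Matrix.of fun i j : Fin 1 => if i.val + j.val + 1 = 1 then (1 : L) else 0)).Local v)] [MeasurableSpace ↥(unitaryGroupOfForm (conjLocal L (IsCMField.complexConj L) v) (cmLocalForm L 3 v))] [BorelSpace ↥(unitaryGroupOfForm (conjLocal L (IsCMField.complexConj L) v) (cmLocalForm L 3 v))]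
    (Ψ : (↥(cmBorelTriple L 2 v).M × ((cmDatum L 1 (Matrix.of fun i j : Fin 1 => if i.val + j.val + 1 = 1 then (1 : L) else 0)).Local v)) ≃ₜ* ↥(cmBorelTriple L 3 v).M)
    (μT₂ : Measure ↥(cmBorelTriple L 2 v).M) [μT₂.IsHaarMeasure] (ν₁ : Measure ((cmDatum L 1 (Matrix.of fun i j : Fin 1 => if i.val + j.val + 1 = 1 then (1 : L) else 0)).Local v)) [ν₁.IsHaarMeasure]
    (C₂ : Subgroup ↥(cmBorelTriple L 2 v).M) (hC₂o : IsOpen (C₂ : Set ↥(cmBorelTriple L 2 v).M)) (hC₂c : IsCompact (C₂ : Set ↥(cmBorelTriple L 2 v).M))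
    (K₁ : Subgroup ((cmDatum L 1 (Matrix.of fun i j : Fin 1 => if i.val + j.val + 1 = 1 then (1 : L) else 0)).Local v)) (hK₁o : IsOpen (K₁ : Set ((cmDatum L 1 (Matrix.of fun i j : Fin 1 => if i.val + j.val + 1 = 1 then (1 : L) else 0)).Local v))) (hK₁c : IsCompact (K₁ : Set ((cmDatum L 1 (Matrix.of fun i j : Fin 1 => if i.val + j.val + 1 = 1 then (1 : L) else 0)).Local v))) :
    (((μT₂.prod ν₁).real (Ψ ⁻¹' {t : ↥(cmBorelTriple L 3 v).M | (t : ↥(unitaryGroupOfForm (conjLocal L (IsCMField.complexConj L) v) (cmLocalForm L 3 v))) ∈ cmLocalIntegralLevel L 3 (Matrix.of fun i j : Fin 3 => if i.val + j.val + 1 = 3 then (1 : L) else 0) v}) : ℝ) : ℂ) /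
        ((μT₂.real (C₂ : Set ↥(cmBorelTriple L 2 v).M) * ν₁.real (K₁ : Set ((cmDatum L 1 (Matrix.of fun i j : Fin 1 => if i.val + j.val + 1 = 1 then (1 : L) else 0)).Local v)) : ℝ) : ℂ) ≠ 0 := by
  haveI : SecondCountableTopology ↥(unitaryGroupOfForm (conjLocal L (IsCMField.complexConj L) v) (cmLocalForm L 2 v)) := secondCountableTopology_local (IsCMField.complexConj L) 2 _ v
  haveI : SecondCountableTopology ((cmDatum L 1 (Matrix.of fun i j : Fin 1 => if i.val + j.val + 1 = 1 then (1 : L) else 0)).Local v) := secondCountableTopology_local (IsCMField.complexConj L) 1 _ v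
  haveI : SecondCountableTopology ↥(unitaryGroupOfForm (conjLocal L (IsCMField.complexConj L) v) (cmLocalForm L 3 v)) := secondCountableTopology_local (IsCMField.complexConj L) 3 _ v
  haveI : SecondCountableTopology ↥(cmBorelTriple L 2 v).M := TopologicalSpace.Subtype.secondCountableTopology _
  haveI : SecondCountableTopology ↥(cmBorelTriple L 3 v).M := TopologicalSpace.Subtype.secondCountableTopology _
  haveI : LocallyCompactSpace ↥(unitaryGroupOfForm (conjLocal L (IsCMField.complexConj L) v) (cmLocalForm L 3 v)) := locallyCompactSpace_local (IsCMField.complexConj L) 3 _ v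
  haveI : LocallyCompactSpace ↥(cmBorelTriple L 3 v).M := (isClosed_cmBorelTriple_M L v).isClosedEmbedding_subtypeVal.locallyCompactSpace
  haveI : LocallyCompactSpace ↥(unitaryGroupOfForm (conjLocal L (IsCMField.complexConj L) v) (cmLocalForm L 2 v)) := locallyCompactSpace_local (IsCMField.complexConj L) 2 _ v
  haveI : T2Space ↥(unitaryGroupOfForm (conjLocal L (IsCMField.complexConj L) v) (cmLocalForm L 2 v)) := t2Space_cmDatum_local 2 L (Matrix.of fun i j : Fin 2 => if i.val + j.val + 1 = 2 then (1 : L) else 0) v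
  haveI : T1Space (LocalRing L v) := inferInstance
  have hTcl := isClosed_torusU_of_t1Space (conjLocal L (IsCMField.complexConj L) v) (cmLocalForm L 2 v)
  haveI : LocallyCompactSpace ↥(cmBorelTriple L 2 v).M := hTcl.isClosedEmbedding_subtypeVal.locallyCompactSpace
  haveI : SigmaCompactSpace ↥(cmBorelTriple L 2 v).M := sigmaCompactSpace_of_locallyCompact_secondCountable
  haveI : LocallyCompactSpace ((cmDatum L 1 (Matrix.of fun i j : Fin 1 => if i.val + j.val + 1 = 1 then (1 : L) else 0)).Local v) := locallyCompactSpace_local (IsCMField.complexConj L) 1 _ v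
  haveI : SigmaCompactSpace ((cmDatum L 1 (Matrix.of fun i j : Fin 1 => if i.val + j.val + 1 = 1 then (1 : L) else 0)).Local v) := sigmaCompactSpace_of_locallyCompact_secondCountable
  haveI : BorelSpace (↥(cmBorelTriple L 2 v).M × ((cmDatum L 1 (Matrix.of fun i j : Fin 1 => if i.val + j.val + 1 = 1 then (1 : L) else 0)).Local v)) := Prod.borelSpace
  have hKco := isCompact_isOpen_cmLocalIntegralLevel L 3 (Matrix.of fun i j : Fin 3 => if i.val + j.val + 1 = 3 then (1 : L) else 0) v
  have hKvo : IsOpen {t : ↥(cmBorelTriple L 3 v).M | (t : ↥(unitaryGroupOfForm (conjLocal L (IsCMField.complexConj L) v) (cmLocalForm L 3 v))) ∈ cmLocalIntegralLevel L 3 (Matrix.of fun i j : Fin 3 => if i.val + j.val + 1 = 3 then (1 : L) else 0) v} := hKco.2.preimage continuous_subtype_val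
  have hKvc : IsCompact {t : ↥(cmBorelTriple L 3 v).M | (t : ↥(unitaryGroupOfForm (conjLocal L (IsCMField.complexConj L) v) (cmLocalForm L 3 v))) ∈ cmLocalIntegralLevel L 3 (Matrix.of fun i j : Fin 3 => if i.val + j.val + 1 = 3 then (1 : L) else 0) v} :=
    (isClosed_cmBorelTriple_M L v).isClosedEmbedding_subtypeVal.isCompact_preimage hKco.1
  have h1o : IsOpen (Ψ ⁻¹' {t : ↥(cmBorelTriple L 3 v).M | (t : ↥(unitaryGroupOfForm (conjLocal L (IsCMField.complexConj L) v) (cmLocalForm L 3 v))) ∈ cmLocalIntegralLevel L 3 (Matrix.of fun i j : Fin 3 => if i.val + j.val + 1 = 3 then (1 : L) else 0) v}) := hKvo.preimage (map_continuous Ψ)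
  have h1c : IsCompact (Ψ ⁻¹' {t : ↥(cmBorelTriple L 3 v).M | (t : ↥(unitaryGroupOfForm (conjLocal L (IsCMField.complexConj L) v) (cmLocalForm L 3 v))) ∈ cmLocalIntegralLevel L 3 (Matrix.of fun i j : Fin 3 => if i.val + j.val + 1 = 3 then (1 : L) else 0) v}) := Ψ.toHomeomorph.isCompact_preimage.2 hKvc
  have h1 : 0 < (μT₂.prod ν₁).real (Ψ ⁻¹' {t : ↥(cmBorelTriple L 3 v).M | (t : ↥(unitaryGroupOfForm (conjLocal L (IsCMField.complexConj L) v) (cmLocalForm L 3 v))) ∈ cmLocalIntegralLevel L 3 (Matrix.of fun i j : Fin 3 => if i.val + j.val + 1 = 3 then (1 : L) else 0) v}) :=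
    F0P3cStCharTSConstants.measureReal_pos_of_isOpen_of_isCompact _ h1o h1c ⟨1, by
      rw [mem_preimage, map_one, Set.mem_setOf_eq, OneMemClass.coe_one]; exact Subgroup.one_mem _⟩
  have h2 : 0 < μT₂.real (C₂ : Set ↥(cmBorelTriple L 2 v).M) * ν₁.real (K₁ : Set ((cmDatum L 1 (Matrix.of fun i j : Fin 1 => if i.val + j.val + 1 = 1 then (1 : L) else 0)).Local v)) :=
    mul_pos (F0P3cStCharTSConstants.measureReal_coe_subgroup_pos μT₂ C₂ hC₂o hC₂c) (F0P3cStCharTSConstants.measureReal_coe_subgroup_pos ν₁ K₁ hK₁o hK₁c)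
  exact div_ne_zero (Complex.ofReal_ne_zero.2 h1.ne') (Complex.ofReal_ne_zero.2 h2.ne')

set_option maxHeartbeats 4000000 in  -- cross-spelling `whnf` (as above)
set_option synthInstance.maxHeartbeats 400000 in
/-- **«HCARD★» IN THE LETTERS OF RECORD** (KAPPA-RATIO sheet v1 c727433790841ad4 §1 (RG)(RH)(CNT), LH6-p02 (g2); road (D) owner LH6-p04 (g3) ruling 07:32:36Z):
with `rG := ((μT.real {t | ↑t ∈ K_{3,v}} : ℝ) : ℂ) ∕ ((μT.real ↑Sn : ℝ) : ℂ)` and `rH := (ν₁.real univ : ℂ) * ((μT₂.real {t | ↑t ∈ K_{2,v}} : ℝ) : ℂ) ∕ ((ν₁.real ↑K₁ : ℂ) * ((μT₂.real ↑C₂ : ℝ) : ℂ))`,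
**`(F.card : ℂ) * rG = rH`** — the `hcard` binder of ★ p850018 `steinbergLabel_smoothTrace_sum_eq_cmXiTorusChar` ∕ ★ CJ-BLOCK at `s := F`, GIVEN «UNIT-SET-Ψ» (`hunit`).
[cite: Rogawski1990, §4.9 Lemma 4.9.2 p. 56; §12.7 L. 12.7.3 (proof) p. 195] [cite: DeitmarEchterhoff2014, Thm. 1.5.3] -/
theorem hcard_of_unitSet
    [MeasurableSpace ↥(unitaryGroupOfForm (conjLocal L (IsCMField.complexConj L) v) (cmLocalForm L 2 v))] [BorelSpace ↥(unitaryGroupOfForm (conjLocal L (IsCMField.complexConj L) v) (cmLocalForm L 2 v))] [MeasurableSpace ((cmDatum L 1 (Matrix.of fun i j : Fin 1 => if i.val + j.val + 1 = 1 then (1 : L) else 0)).Local v)] [BorelSpace ((cmDatum L 1 (Matrix.of fun i j : Fin 1 => if i.val + j.val + 1 = 1 then (1 : L) else 0)).Local v)] [MeasurableSpace ↥(unitaryGroupOfForm (conjLocal L (IsCMField.complexConj L) v) (cmLocalForm L 3 v))] [BorelSpace ↥(unitaryGroupOfForm (conjLocal L (IsCMField.complexConj L) v) (cmLocalForm L 3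 v))]
    (Ψ : (↥(cmBorelTriple L 2 v).M × ((cmDatum L 1 (Matrix.of fun i j : Fin 1 => if i.val + j.val + 1 = 1 then (1 : L) else 0)).Local v)) ≃ₜ* ↥(cmBorelTriple L 3 v).M)
    (hΨ : ∀ x : (↥(cmBorelTriple L 2 v).M × ((cmDatum L 1 (Matrix.of fun i j : Fin 1 => if i.val + j.val + 1 = 1 then (1 : L) else 0)).Local v)), (((Ψ x : ↥(cmBorelTriple L 3 v).M)) : ↥(unitaryGroupOfForm (conjLocal L (IsCMField.complexConj L) v) (cmLocalForm L 3 v))) = endoEmbLocal L v ((x.1 : ↥(unitaryGroupOfForm (conjLocal L (IsCMField.complexConj L) v) (cmLocalForm L 2 v))), x.2))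
    (μT : Measure ↥(cmBorelTriple L 3 v).M) [μT.IsHaarMeasure] (μT₂ : Measure ↥(cmBorelTriple L 2 v).M) [μT₂.IsHaarMeasure] (ν₁ : Measure ((cmDatum L 1 (Matrix.of fun i j : Fin 1 => if i.val + j.val + 1 = 1 then (1 : L) else 0)).Local v)) [ν₁.IsHaarMeasure]
    (Sn : Subgroup ↥(cmBorelTriple L 3 v).M) (hSnc : IsCompact (Sn : Set ↥(cmBorelTriple L 3 v).M)) (hSno : IsOpen (Sn : Set ↥(cmBorelTriple L 3 v).M)) (b' : ↥(cmBorelTriple L 3 v).M)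
    (C₂ : Subgroup ↥(cmBorelTriple L 2 v).M) (hC₂o : IsOpen (C₂ : Set ↥(cmBorelTriple L 2 v).M)) (hC₂c : IsCompact (C₂ : Set ↥(cmBorelTriple L 2 v).M))
    (K₁ : Subgroup ((cmDatum L 1 (Matrix.of fun i j : Fin 1 => if i.val + j.val + 1 = 1 then (1 : L) else 0)).Local v)) (hK₁o : IsOpen (K₁ : Set ((cmDatum L 1 (Matrix.of fun i j : Fin 1 => if i.val + j.val + 1 = 1 then (1 : L) else 0)).Local v))) (hK₁c : IsCompact (K₁ : Set ((cmDatum L 1 (Matrix.of fun i j : Fin 1 => if i.val + j.val + 1 = 1 then (1 : L) else 0)).Local v)))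
    (F : Finset (↥(cmBorelTriple L 2 v).M × ((cmDatum L 1 (Matrix.of fun i j : Fin 1 => if i.val + j.val + 1 = 1 then (1 : L) else 0)).Local v)))
    (hcover : (fun x : (↥(cmBorelTriple L 2 v).M × ((cmDatum L 1 (Matrix.of fun i j : Fin 1 => if i.val + j.val + 1 = 1 then (1 : L) else 0)).Local v)) => endoEmbLocal L v ((x.1 : ↥(unitaryGroupOfForm (conjLocal L (IsCMField.complexConj L) v) (cmLocalForm L 2 v))), x.2)) ⁻¹' (Subtype.val '' (b' • (Sn : Set ↥(cmBorelTriple L 3 v).M))) = ⋃ u ∈ F, u • ((C₂.prod K₁ : Subgroup (↥(cmBorelTriple L 2 v).M × ((cmDatum L 1 (Matrix.of fun i j : Fin 1 => if i.val + j.val + 1 = 1 then (1 : L) else 0)).Local v))) : Set (↥(cmBorelTriple L 2 v).M × ((cmDatum L 1 (Matrix.of fun i j : Fin 1 => if i.val + j.val + 1 = 1 then (1 : L) else 0)).Local v))))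
    (hdisj : (↑F : Set (↥(cmBorelTriple L 2 v).M × ((cmDatum L 1 (Matrix.of fun i j : Fin 1 => if i.val + j.val + 1 = 1 then (1 : L) else 0)).Local v))).PairwiseDisjoint (fun u => u • ((C₂.prod K₁ : Subgroup (↥(cmBorelTriple L 2 v).M × ((cmDatum L 1 (Matrix.of fun i j : Fin 1 => if i.val + j.val + 1 = 1 then (1 : L) else 0)).Local v))) : Set (↥(cmBorelTriple L 2 v).M × ((cmDatum L 1 (Matrix.of fun i j : Fin 1 => if i.val + j.val + 1 = 1 then (1 : L) else 0)).Local v)))))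
    (hunit : Ψ ⁻¹' {t : ↥(cmBorelTriple L 3 v).M | (t : ↥(unitaryGroupOfForm (conjLocal L (IsCMField.complexConj L) v) (cmLocalForm L 3 v))) ∈ cmLocalIntegralLevel L 3 (Matrix.of fun i j : Fin 3 => if i.val + j.val + 1 = 3 then (1 : L) else 0) v} = {x : (↥(cmBorelTriple L 2 v).M × ((cmDatum L 1 (Matrix.of fun i j : Fin 1 => if i.val + j.val + 1 = 1 then (1 : L) else 0)).Local v)) | (x.1 : ↥(unitaryGroupOfForm (conjLocal L (IsCMField.complexConj L) v) (cmLocalForm L 2 v))) ∈ cmLocalIntegralLevel L 2 (Matrix.of fun i j : Fin 2 => if i.val + j.val + 1 = 2 then (1 : L) else 0) v}) :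
    (F.card : ℂ) * (((μT.real {t : ↥(cmBorelTriple L 3 v).M | (t : ↥(unitaryGroupOfForm (conjLocal L (IsCMField.complexConj L) v) (cmLocalForm L 3 v))) ∈ cmLocalIntegralLevel L 3 (Matrix.of fun i j : Fin 3 => if i.val + j.val + 1 = 3 then (1 : L) else 0) v} : ℝ) : ℂ) / ((μT.real (Sn : Set ↥(cmBorelTriple L 3 v).M) : ℝ) : ℂ)) =
      ((ν₁.real Set.univ : ℝ) : ℂ) * ((μT₂.real {t : ↥(cmBorelTriple L 2 v).M | (t : ↥(unitaryGroupOfForm (conjLocal L (IsCMField.complexConj L) v) (cmLocalForm L 2 v))) ∈ cmLocalIntegralLevel L 2 (Matrix.of fun i j : Fin 2 => if i.val + j.val + 1 = 2 then (1 : L) else 0) v} : ℝ) : ℂ) /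
        (((ν₁.real (K₁ : Set ((cmDatum L 1 (Matrix.of fun i j : Fin 1 => if i.val + j.val + 1 = 1 then (1 : L) else 0)).Local v)) : ℝ) : ℂ) * ((μT₂.real (C₂ : Set ↥(cmBorelTriple L 2 v).M) : ℝ) : ℂ)) := by
  haveI : SecondCountableTopology ↥(unitaryGroupOfForm (conjLocal L (IsCMField.complexConj L) v) (cmLocalForm L 2 v)) := secondCountableTopology_local (IsCMField.complexConj L) 2 _ v
  haveI : SecondCountableTopology ((cmDatum L 1 (Matrix.of fun i j : Fin 1 => if i.val + j.val + 1 = 1 then (1 : L) else 0)).Local v) := secondCountableTopology_local (IsCMField.complexConj L) 1 _ v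
  haveI : SecondCountableTopology ↥(unitaryGroupOfForm (conjLocal L (IsCMField.complexConj L) v) (cmLocalForm L 3 v)) := secondCountableTopology_local (IsCMField.complexConj L) 3 _ v
  haveI : SecondCountableTopology ↥(cmBorelTriple L 2 v).M := TopologicalSpace.Subtype.secondCountableTopology _
  haveI : SecondCountableTopology ↥(cmBorelTriple L 3 v).M := TopologicalSpace.Subtype.secondCountableTopology _
  haveI : LocallyCompactSpace ↥(unitaryGroupOfForm (conjLocal L (IsCMField.complexConj L) v) (cmLocalForm L 3 v)) := locallyCompactSpace_local (IsCMField.complexConj L) 3 _ v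
  haveI : LocallyCompactSpace ↥(cmBorelTriple L 3 v).M := (isClosed_cmBorelTriple_M L v).isClosedEmbedding_subtypeVal.locallyCompactSpace
  haveI : LocallyCompactSpace ↥(unitaryGroupOfForm (conjLocal L (IsCMField.complexConj L) v) (cmLocalForm L 2 v)) := locallyCompactSpace_local (IsCMField.complexConj L) 2 _ v
  haveI : T2Space ↥(unitaryGroupOfForm (conjLocal L (IsCMField.complexConj L) v) (cmLocalForm L 2 v)) := t2Space_cmDatum_local 2 L (Matrix.of fun i j : Fin 2 => if i.val + j.val + 1 = 2 then (1 : L) else 0) v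
  haveI : T1Space (LocalRing L v) := inferInstance
  have hTcl := isClosed_torusU_of_t1Space (conjLocal L (IsCMField.complexConj L) v) (cmLocalForm L 2 v)
  haveI : LocallyCompactSpace ↥(cmBorelTriple L 2 v).M := hTcl.isClosedEmbedding_subtypeVal.locallyCompactSpace
  haveI : SigmaCompactSpace ↥(cmBorelTriple L 2 v).M := sigmaCompactSpace_of_locallyCompact_secondCountable
  haveI : LocallyCompactSpace ((cmDatum L 1 (Matrix.of fun i j : Fin 1 => if i.val + j.val + 1 = 1 then (1 : L) else 0)).Local v) := locallyCompactSpace_local (IsCMField.complexConj L) 1 _ v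
  haveI : SigmaCompactSpace ((cmDatum L 1 (Matrix.of fun i j : Fin 1 => if i.val + j.val + 1 = 1 then (1 : L) else 0)).Local v) := sigmaCompactSpace_of_locallyCompact_secondCountable
  haveI : BorelSpace (↥(cmBorelTriple L 2 v).M × ((cmDatum L 1 (Matrix.of fun i j : Fin 1 => if i.val + j.val + 1 = 1 then (1 : L) else 0)).Local v)) := Prod.borelSpace
  have hset : {x : (↥(cmBorelTriple L 2 v).M × ((cmDatum L 1 (Matrix.of fun i j : Fin 1 => if i.val + j.val + 1 = 1 then (1 : L) else 0)).Local v)) | (x.1 : ↥(unitaryGroupOfForm (conjLocal L (IsCMField.complexConj L) v) (cmLocalForm L 2 v))) ∈ cmLocalIntegralLevel L 2 (Matrix.of fun i j : Fin 2 => if i.val + j.val + 1 = 2 then (1 : L) else 0) v} = {t : ↥(cmBorelTriple L 2 v).M | (t : ↥(unitaryGroupOfForm (conjLocal L (IsCMField.complexConj L) v) (cmLocalForm L 2 v))) ∈ cmLocalIntegralLevel L 2 (Matrix.of fun i j : Fin 2 => if i.val + j.val + 1 = 2 then (1 : L) else 0) v} ×ˢ (Set.univ : Set ((cmDatum L 1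 (Matrix.of fun i j : Fin 1 => if i.val + j.val + 1 = 1 then (1 : L) else 0)).Local v)) :=
    Set.ext fun x => ⟨fun h => ⟨h, Set.mem_univ _⟩, fun h => h.1⟩
  rw [card_mul_rG_eq_preimage_form L v Ψ hΨ μT μT₂ ν₁ Sn hSnc hSno b' C₂ hC₂o hC₂c K₁ hK₁o hK₁c F hcover hdisj, hunit, hset,
    measureReal_prod_prod]
  push_cast
  ring

set_option maxHeartbeats 4000000 in  -- cross-spelling `whnf` (as above)
set_option synthInstance.maxHeartbeats 400000 in
/-- **`rH ≠ 0` IN THE LETTERS OF RECORD** (sheet v1 §1 (RH)): `(ν₁.real univ : ℂ) * ((μT₂.real {t | ↑t ∈ K_{2,v}} : ℝ) : ℂ) ∕ ((ν₁.real ↑K₁ : ℂ) * ((μT₂.real ↑C₂ : ℝ) : ℂ)) ≠ 0`, GIVEN «UNIT-SET-Ψ» —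
the `hrH` binder of ★ p850018. [cite: HewittRoss1979, (15.8)] [cite: Rogawski1990, §12.7 L. 12.7.3 (proof) p. 195] -/
theorem hrH_of_unitSet
    [MeasurableSpace ↥(unitaryGroupOfForm (conjLocal L (IsCMField.complexConj L) v) (cmLocalForm L 2 v))] [BorelSpace ↥(unitaryGroupOfForm (conjLocal L (IsCMField.complexConj L) v) (cmLocalForm L 2 v))] [MeasurableSpace ((cmDatum L 1 (Matrix.of fun i j : Fin 1 => if i.val + j.val + 1 = 1 then (1 : L) else 0)).Local v)] [BorelSpace ((cmDatum L 1 (Matrix.of fun i j : Fin 1 => if i.val + j.val + 1 = 1 then (1 : L) else 0)).Local v)] [MeasurableSpace ↥(unitaryGroupOfForm (conjLocal L (IsCMField.complexConj L) v) (cmLocalForm L 3 v))] [BorelSpace ↥(unitaryGroupOfForm (conjLocal L (IsCMField.complexConj L) v) (cmLocalForm L 3 v))]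
    (Ψ : (↥(cmBorelTriple L 2 v).M × ((cmDatum L 1 (Matrix.of fun i j : Fin 1 => if i.val + j.val + 1 = 1 then (1 : L) else 0)).Local v)) ≃ₜ* ↥(cmBorelTriple L 3 v).M)
    (μT₂ : Measure ↥(cmBorelTriple L 2 v).M) [μT₂.IsHaarMeasure] (ν₁ : Measure ((cmDatum L 1 (Matrix.of fun i j : Fin 1 => if i.val + j.val + 1 = 1 then (1 : L) else 0)).Local v)) [ν₁.IsHaarMeasure]
    (C₂ : Subgroup ↥(cmBorelTriple L 2 v).M) (hC₂o : IsOpen (C₂ : Set ↥(cmBorelTriple L 2 v).M)) (hC₂c : IsCompact (C₂ : Set ↥(cmBorelTriple L 2 v).M))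
    (K₁ : Subgroup ((cmDatum L 1 (Matrix.of fun i j : Fin 1 => if i.val + j.val + 1 = 1 then (1 : L) else 0)).Local v)) (hK₁o : IsOpen (K₁ : Set ((cmDatum L 1 (Matrix.of fun i j : Fin 1 => if i.val + j.val + 1 = 1 then (1 : L) else 0)).Local v))) (hK₁c : IsCompact (K₁ : Set ((cmDatum L 1 (Matrix.of fun i j : Fin 1 => if i.val + j.val + 1 = 1 then (1 : L) else 0)).Local v)))
    (hunit : Ψ ⁻¹' {t : ↥(cmBorelTriple L 3 v).M | (t : ↥(unitaryGroupOfForm (conjLocal L (IsCMField.complexConj L) v) (cmLocalForm L 3 v))) ∈ cmLocalIntegralLevel L 3 (Matrix.of fun i j : Fin 3 => if i.val + j.val + 1 = 3 then (1 : L) else 0) v} = {x : (↥(cmBorelTriple L 2 v).M × ((cmDatum L 1 (Matrix.of fun i j : Fin 1 => if i.val + j.val + 1 = 1 then (1 : L) else 0)).Local v)) | (x.1 : ↥(unitaryGroupOfForm (conjLocal L (IsCMField.complexConj L) v) (cmLocalForm L 2 v))) ∈ cmLocalIntegralLevel L 2 (Matrix.of fun i j : Fin 2 => if i.val + j.val +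 1 = 2 then (1 : L) else 0) v}) :
    ((ν₁.real Set.univ : ℝ) : ℂ) * ((μT₂.real {t : ↥(cmBorelTriple L 2 v).M | (t : ↥(unitaryGroupOfForm (conjLocal L (IsCMField.complexConj L) v) (cmLocalForm L 2 v))) ∈ cmLocalIntegralLevel L 2 (Matrix.of fun i j : Fin 2 => if i.val + j.val + 1 = 2 then (1 : L) else 0) v} : ℝ) : ℂ) /
        (((ν₁.real (K₁ : Set ((cmDatum L 1 (Matrix.of fun i j : Fin 1 => if i.val + j.val + 1 = 1 then (1 : L) else 0)).Local v)) : ℝ) : ℂ) * ((μT₂.real (C₂ : Set ↥(cmBorelTriple L 2 v).M) : ℝ) : ℂ)) ≠ 0 := by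
  haveI : SecondCountableTopology ↥(unitaryGroupOfForm (conjLocal L (IsCMField.complexConj L) v) (cmLocalForm L 2 v)) := secondCountableTopology_local (IsCMField.complexConj L) 2 _ v
  haveI : SecondCountableTopology ((cmDatum L 1 (Matrix.of fun i j : Fin 1 => if i.val + j.val + 1 = 1 then (1 : L) else 0)).Local v) := secondCountableTopology_local (IsCMField.complexConj L) 1 _ v
  haveI : SecondCountableTopology ↥(unitaryGroupOfForm (conjLocal L (IsCMField.complexConj L) v) (cmLocalForm L 3 v)) := secondCountableTopology_local (IsCMField.complexConj L) 3 _ v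
  haveI : SecondCountableTopology ↥(cmBorelTriple L 2 v).M := TopologicalSpace.Subtype.secondCountableTopology _
  haveI : SecondCountableTopology ↥(cmBorelTriple L 3 v).M := TopologicalSpace.Subtype.secondCountableTopology _
  haveI : LocallyCompactSpace ↥(unitaryGroupOfForm (conjLocal L (IsCMField.complexConj L) v) (cmLocalForm L 3 v)) := locallyCompactSpace_local (IsCMField.complexConj L) 3 _ v
  haveI : LocallyCompactSpace ↥(cmBorelTriple L 3 v).M := (isClosed_cmBorelTriple_M L v).isClosedEmbedding_subtypeVal.locallyCompactSpace
  haveI : LocallyCompactSpace ↥(unitaryGroupOfForm (conjLocal L (IsCMField.complexConj L) v) (cmLocalForm L 2 v)) := locallyCompactSpace_local (IsCMField.complexConj L) 2 _ v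
  haveI : T2Space ↥(unitaryGroupOfForm (conjLocal L (IsCMField.complexConj L) v) (cmLocalForm L 2 v)) := t2Space_cmDatum_local 2 L (Matrix.of fun i j : Fin 2 => if i.val + j.val + 1 = 2 then (1 : L) else 0) v
  haveI : T1Space (LocalRing L v) := inferInstance
  have hTcl := isClosed_torusU_of_t1Space (conjLocal L (IsCMField.complexConj L) v) (cmLocalForm L 2 v)
  haveI : LocallyCompactSpace ↥(cmBorelTriple L 2 v).M := hTcl.isClosedEmbedding_subtypeVal.locallyCompactSpace
  haveI : SigmaCompactSpace ↥(cmBorelTriple L 2 v).M := sigmaCompactSpace_of_locallyCompact_secondCountable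
  haveI : LocallyCompactSpace ((cmDatum L 1 (Matrix.of fun i j : Fin 1 => if i.val + j.val + 1 = 1 then (1 : L) else 0)).Local v) := locallyCompactSpace_local (IsCMField.complexConj L) 1 _ v
  haveI : SigmaCompactSpace ((cmDatum L 1 (Matrix.of fun i j : Fin 1 => if i.val + j.val + 1 = 1 then (1 : L) else 0)).Local v) := sigmaCompactSpace_of_locallyCompact_secondCountable
  haveI : BorelSpace (↥(cmBorelTriple L 2 v).M × ((cmDatum L 1 (Matrix.of fun i j : Fin 1 => if i.val + j.val + 1 = 1 then (1 : L) else 0)).Local v)) := Prod.borelSpace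
  have hset : {x : (↥(cmBorelTriple L 2 v).M × ((cmDatum L 1 (Matrix.of fun i j : Fin 1 => if i.val + j.val + 1 = 1 then (1 : L) else 0)).Local v)) | (x.1 : ↥(unitaryGroupOfForm (conjLocal L (IsCMField.complexConj L) v) (cmLocalForm L 2 v))) ∈ cmLocalIntegralLevel L 2 (Matrix.of fun i j : Fin 2 => if i.val + j.val + 1 = 2 then (1 : L) else 0) v} = {t : ↥(cmBorelTriple L 2 v).M | (t : ↥(unitaryGroupOfForm (conjLocal L (IsCMField.complexConj L) v) (cmLocalForm L 2 v))) ∈ cmLocalIntegralLevel L 2 (Matrix.of fun i j : Fin 2 => if i.val + j.val + 1 = 2 then (1 : L) else 0) v} ×ˢ (Set.univ : Set ((cmDatum L 1 (Matrix.of fun i j : Fin 1 => if i.val + j.val + 1 = 1 then (1 : L) else 0)).Local v)) :=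
    Set.ext fun x => ⟨fun h => ⟨h, Set.mem_univ _⟩, fun h => h.1⟩
  have h := rH_preimage_form_ne_zero L v Ψ μT₂ ν₁ C₂ hC₂o hC₂c K₁ hK₁o hK₁c
  rw [hunit, hset, measureReal_prod_prod] at h
  have e : ((ν₁.real Set.univ : ℝ) : ℂ) * ((μT₂.real {t : ↥(cmBorelTriple L 2 v).M | (t : ↥(unitaryGroupOfForm (conjLocal L (IsCMField.complexConj L) v) (cmLocalForm L 2 v))) ∈ cmLocalIntegralLevel L 2 (Matrix.of fun i j : Fin 2 => if i.val + j.val + 1 = 2 then (1 : L) else 0) v} : ℝ) : ℂ) /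
        (((ν₁.real (K₁ : Set ((cmDatum L 1 (Matrix.of fun i j : Fin 1 => if i.val + j.val + 1 = 1 then (1 : L) else 0)).Local v)) : ℝ) : ℂ) * ((μT₂.real (C₂ : Set ↥(cmBorelTriple L 2 v).M) : ℝ) : ℂ)) =
      ((μT₂.real {t : ↥(cmBorelTriple L 2 v).M | (t : ↥(unitaryGroupOfForm (conjLocal L (IsCMField.complexConj L) v) (cmLocalForm L 2 v))) ∈ cmLocalIntegralLevel L 2 (Matrix.of fun i j : Fin 2 => if i.val + j.val + 1 = 2 then (1 : L) else 0) v} * ν₁.real Set.univ : ℝ) : ℂ) /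
        ((μT₂.real (C₂ : Set ↥(cmBorelTriple L 2 v).M) * ν₁.real (K₁ : Set ((cmDatum L 1 (Matrix.of fun i j : Fin 1 => if i.val + j.val + 1 = 1 then (1 : L) else 0)).Local v)) : ℝ) : ℂ) := by
    push_cast; ring
  rwa [e]

end CM

/-! ## §3 «UNIT-SET-Ψ»: `Ψ_T⁻¹(T₃ ∩ K_v) = (T₂ ∩ K_{2,v}) × U(Φ₁)_v` at a non-split place -/

section UnitSet

/-- **Converse of ★ `endoGL_mem_glInt` on the first block**: `ι(a, b) ∈ GL₃(𝒪) ⇒ a ∈ GL₂(𝒪)` — the entries of `a` and of `a⁻¹` are entries of `ι(a,b)` and of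
`ι(a,b)⁻¹ = ι(a⁻¹, b⁻¹)` (★ `coe_endoGL_eq`). [cite: Rogawski1990, §4.8 Case (a) p. 53; §4.9 p. 54] -/
theorem mem_glInt_of_endoGL_mem_glInt {F : Type*} [Field F] [ValuativeRel F] {a : GL (Fin 2) F} {b : GL (Fin 1) F}
    (h : endoGL (a, b) ∈ glInt 3 F) : a ∈ glInt 2 F := by
  obtain ⟨h1, h2⟩ := (mem_glInt_iff _).1 h
  rw [← map_inv, Prod.inv_mk] at h2
  have key : ∀ {a' : GL (Fin 2) F} {b' : GL (Fin 1) F}, (∀ i j, ((endoGL (a', b') : GL (Fin 3) F) : Matrix (Fin 3) (Fin 3) F) i j ∈ 𝒪[F]) →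
      ∀ i j, (a' : Matrix (Fin 2) (Fin 2) F) i j ∈ 𝒪[F] := by
    intro a' b' h' i j
    have h00 := h' 0 0; have h02 := h' 0 2; have h20 := h' 2 0; have h22 := h' 2 2
    rw [coe_endoGL_eq] at h00 h02 h20 h22
    fin_cases i <;> fin_cases j
    · simpa using h00
    · simpa using h02
    · simpa using h20
    · simpa using h22
  exact (mem_glInt_iff a).2 ⟨key h1, key h2⟩

variable (L : Type) [Field L] [NumberField L] [IsCMField L] (v : HeightOneSpectrum (𝓞 ↥(maximalRealSubfield L)))

set_option maxHeartbeats 4000000 in  -- cross-spelling `whnf` (as above)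
set_option synthInstance.maxHeartbeats 400000 in
/-- **«UNIT-SET-Ψ» on `H_v`**: at a non-split place (`c • w = w`), `ι_v(γ₂, γ₁) ∈ K_v = U(Φ₃)(𝒪_v) ↔ γ₂ ∈ K_{2,v} = U(Φ₂)(𝒪_v)` for EVERY `γ₁ ∈ U(Φ₁)(L⁺_v)` (`= U(Φ₁)(𝒪_v)`,
★ `cmLocalIntegralLevel_one_eq_top_of_smul_eq`): «⇐» is ★ `endoEmbLocal_mem_cmLocalIntegralLevel_of_nonsplit`; «⇒» reads the `w`-component `ι(γ_{2,w}, γ_{1,w})` (★ `map_endoGL`)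
in `GL₃(𝒪_w)` (★ `mem_localIntegralLevel_iff_of_smul_eq`) and extracts the corner block. [cite: Rogawski1990, §4.9 p. 54] [cite: PlatonovRapinchuk1994, §5.1] -/
theorem endoEmbLocal_mem_cmLocalIntegralLevel_iff_of_nonsplit (w : PlacesOver L v) (hw : IsCMField.complexConj L • w.1 = w.1)
    (γH : ((cmDatum L 2 (Matrix.of fun i j : Fin 2 => if i.val + j.val + 1 = 2 then (1 : L) else 0)).Local v) × ((cmDatum L 1 (Matrix.of fun i j : Fin 1 => if i.val + j.val + 1 = 1 then (1 : L) else 0)).Local v)) :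
    endoEmbLocal L v γH ∈ cmLocalIntegralLevel L 3 (Matrix.of fun i j : Fin 3 => if i.val + j.val + 1 = 3 then (1 : L) else 0) v ↔ γH.1 ∈ cmLocalIntegralLevel L 2 (Matrix.of fun i j : Fin 2 => if i.val + j.val + 1 = 2 then (1 : L) else 0) v := by
  have hc := IsCMField.complexConj_ne_one L
  have hK1 : cmLocalIntegralLevel L 1 (Matrix.of fun i j : Fin 1 => if i.val + j.val + 1 = 1 then (1 : L) else 0) v = ⊤ :=
    cmLocalIntegralLevel_one_eq_top_of_smul_eq L _ w hw (isUnit_placeForm_antidiagOne (E := L) 1 w.1)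
  refine ⟨fun h => ?_, fun h => endoEmbLocal_mem_cmLocalIntegralLevel_of_nonsplit L w hw (Subgroup.mem_prod.2 ⟨h, by rw [hK1]; exact Subgroup.mem_top _⟩)⟩
  have h3 := (mem_localIntegralLevel_iff_of_smul_eq (IsCMField.complexConj L) 3 _ hc w hw (endoEmbLocal L v γH)).1 h
  have hval : ((localNonsplitEquiv (IsCMField.complexConj L) (Matrix.of fun i j : Fin 3 => if i.val + j.val + 1 = 3 then (1 : L) else 0) hc w hw (endoEmbLocal L v γH) :
        unitaryGroupOfForm (galAdicCompletionMap (L := L) (IsCMField.complexConj L) hw) (placeForm (Matrix.of fun i j : Fin 3 => if i.val + j.val + 1 = 3 then (1 : L) else 0) w.1)) :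
        GL (Fin 3) (w.1.adicCompletion L)) =
      endoGL
        (((localNonsplitEquiv (IsCMField.complexConj L) (Matrix.of fun i j : Fin 2 => if i.val + j.val + 1 = 2 then (1 : L) else 0) hc w hw γH.1 :
            unitaryGroupOfForm (galAdicCompletionMap (L := L) (IsCMField.complexConj L) hw) (placeForm (Matrix.of fun i j : Fin 2 => if i.val + j.val + 1 = 2 then (1 : L) else 0) w.1)) :
            GL (Fin 2) (w.1.adicCompletion L)),
          ((localNonsplitEquiv (IsCMField.complexConj L) (Matrix.of fun i j : Fin 1 => if i.val + j.val + 1 = 1 then (1 : L) else 0) hc w hw γH.2 :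
            unitaryGroupOfForm (galAdicCompletionMap (L := L) (IsCMField.complexConj L) hw) (placeForm (Matrix.of fun i j : Fin 1 => if i.val + j.val + 1 = 1 then (1 : L) else 0) w.1)) :
            GL (Fin 1) (w.1.adicCompletion L))) := by
    have h := map_endoGL (Pi.evalRingHom (fun w' : PlacesOver L v => w'.1.adicCompletion L) w)
      ((γH.1.val : GL (Fin 2) (LocalRing L v)), (γH.2.val : GL (Fin 1) (LocalRing L v)))
    exact Units.ext (congrArg Units.val h)
  rw [hval] at h3
  exact (mem_localIntegralLevel_iff_of_smul_eq (IsCMField.complexConj L) 2 _ hc w hw γH.1).2 (mem_glInt_of_endoGL_mem_glInt h3)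

set_option maxHeartbeats 4000000 in  -- cross-spelling `whnf` (as above)
set_option synthInstance.maxHeartbeats 400000 in
/-- **«UNIT-SET-Ψ»**: for the torus isomorphism `Ψ_T : T₂ × U(Φ₁)_v ≃ₜ* T₃` with `↑(Ψ_T x) = ι_v(↑x.1, x.2)` (★ `exists_torusIso`), at a non-split place:
`Ψ_T⁻¹ {t : T₃ | ↑t ∈ K_v} = {x | ↑x.1 ∈ K_{2,v}}` — the `hunit` input of `hcard_of_unitSet` ∕ `hrH_of_unitSet`. [cite: Rogawski1990, §4.9 p. 54; §12.7 L. 12.7.3 (proof) p. 195] -/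
theorem preimage_torusIso_unitSet (w : PlacesOver L v) (hw : IsCMField.complexConj L • w.1 = w.1)
    (Ψ : (↥(cmBorelTriple L 2 v).M × ((cmDatum L 1 (Matrix.of fun i j : Fin 1 => if i.val + j.val + 1 = 1 then (1 : L) else 0)).Local v)) ≃ₜ* ↥(cmBorelTriple L 3 v).M)
    (hΨ : ∀ x : (↥(cmBorelTriple L 2 v).M × ((cmDatum L 1 (Matrix.of fun i j : Fin 1 => if i.val + j.val + 1 = 1 then (1 : L) else 0)).Local v)), (((Ψ x : ↥(cmBorelTriple L 3 v).M)) : ↥(unitaryGroupOfForm (conjLocal L (IsCMField.complexConj L) v) (cmLocalForm L 3 v))) = endoEmbLocal L v ((x.1 : ↥(unitaryGroupOfForm (conjLocal L (IsCMField.complexConj L) v) (cmLocalForm L 2 v))), x.2)) :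
    Ψ ⁻¹' {t : ↥(cmBorelTriple L 3 v).M | (t : ↥(unitaryGroupOfForm (conjLocal L (IsCMField.complexConj L) v) (cmLocalForm L 3 v))) ∈ cmLocalIntegralLevel L 3 (Matrix.of fun i j : Fin 3 => if i.val + j.val + 1 = 3 then (1 : L) else 0) v} = {x : (↥(cmBorelTriple L 2 v).M × ((cmDatum L 1 (Matrix.of fun i j : Fin 1 => if i.val + j.val + 1 = 1 then (1 : L) else 0)).Local v)) | (x.1 : ↥(unitaryGroupOfForm (conjLocal L (IsCMField.complexConj L) v) (cmLocalForm L 2 v))) ∈ cmLocalIntegralLevel L 2 (Matrix.of fun i j : Fin 2 => if i.val + j.val + 1 = 2 then (1 : L) else 0) v} := by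
  ext x
  rw [mem_preimage, Set.mem_setOf_eq, Set.mem_setOf_eq, hΨ x]
  exact endoEmbLocal_mem_cmLocalIntegralLevel_iff_of_nonsplit L v w hw ((x.1 : ↥(unitaryGroupOfForm (conjLocal L (IsCMField.complexConj L) v) (cmLocalForm L 2 v))), x.2)

end UnitSet

/-! ## §4 The VALUE-third binders `hcard`, `hrH` — hypothesis-free at a non-split place -/

section Heads

variable (L : Type) [Field L] [NumberField L] [IsCMField L] (v : HeightOneSpectrum (𝓞 ↥(maximalRealSubfield L)))

set_option maxHeartbeats 4000000 in  -- cross-spelling `whnf` (as above)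
set_option synthInstance.maxHeartbeats 400000 in
/-- **«HCARD★» — the `hcard` binder of ★ p850018 ∕ ★ CJ-BLOCK at `s := F` in the letters of record** (sheet v1 §1: `rG := ((μT.real {t | ↑t ∈ K_{3,v}} : ℝ) : ℂ) ∕ ((μT.real ↑Sn : ℝ) : ℂ)`,
`rH := (ν₁.real univ : ℂ) * ((μT₂.real {t | ↑t ∈ K_{2,v}} : ℝ) : ℂ) ∕ ((ν₁.real ↑K₁ : ℂ) * ((μT₂.real ↑C₂ : ℝ) : ℂ))`), at a NON-SPLIT place, no unit-set hypothesis: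
**`(F.card : ℂ) * rG = rH`**.  Inputs: ★ `exists_torusIso`'s `Ψ` with its formula, the three torus∕`U(Φ₁)` Haar measures, XIG-DATA's `Sn`, `b′`, `F`, cover ③ and disjointness ② at
`S′ := C₂.prod K₁`. [cite: Rogawski1990, §4.9 Lemma 4.9.2 p. 56; §12.7 L. 12.7.3 (proof) p. 195] [cite: DeitmarEchterhoff2014, Thm. 1.5.3] -/
theorem hcard (w : PlacesOver L v) (hw : IsCMField.complexConj L • w.1 = w.1)
    [MeasurableSpace ↥(unitaryGroupOfForm (conjLocal L (IsCMField.complexConj L) v) (cmLocalForm L 2 v))] [BorelSpace ↥(unitaryGroupOfForm (conjLocal L (IsCMField.complexConj L) v) (cmLocalForm L 2 v))] [MeasurableSpace ((cmDatum L 1 (Matrix.of fun i j : Fin 1 => if i.val + j.val + 1 = 1 then (1 : L) else 0)).Local v)] [BorelSpace ((cmDatum L 1 (Matrix.of fun i j : Fin 1 => if i.val + j.val + 1 = 1 then (1 : L) else 0)).Local v)] [MeasurableSpace ↥(unitaryGroupOfForm (conjLocal L (IsCMField.complexConj L) v) (cmLocalForm L 3 v))] [BorelSpace ↥(unitaryGroupOfForm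 (conjLocal L (IsCMField.complexConj L) v) (cmLocalForm L 3 v))]
    (Ψ : (↥(cmBorelTriple L 2 v).M × ((cmDatum L 1 (Matrix.of fun i j : Fin 1 => if i.val + j.val + 1 = 1 then (1 : L) else 0)).Local v)) ≃ₜ* ↥(cmBorelTriple L 3 v).M)
    (hΨ : ∀ x : (↥(cmBorelTriple L 2 v).M × ((cmDatum L 1 (Matrix.of fun i j : Fin 1 => if i.val + j.val + 1 = 1 then (1 : L) else 0)).Local v)), (((Ψ x : ↥(cmBorelTriple L 3 v).M)) : ↥(unitaryGroupOfForm (conjLocal L (IsCMField.complexConj L) v) (cmLocalForm L 3 v))) = endoEmbLocal L v ((x.1 : ↥(unitaryGroupOfForm (conjLocal L (IsCMField.complexConj L) v) (cmLocalForm L 2 v))), x.2))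
    (μT : Measure ↥(cmBorelTriple L 3 v).M) [μT.IsHaarMeasure] (μT₂ : Measure ↥(cmBorelTriple L 2 v).M) [μT₂.IsHaarMeasure] (ν₁ : Measure ((cmDatum L 1 (Matrix.of fun i j : Fin 1 => if i.val + j.val + 1 = 1 then (1 : L) else 0)).Local v)) [ν₁.IsHaarMeasure]
    (Sn : Subgroup ↥(cmBorelTriple L 3 v).M) (hSnc : IsCompact (Sn : Set ↥(cmBorelTriple L 3 v).M)) (hSno : IsOpen (Sn : Set ↥(cmBorelTriple L 3 v).M)) (b' : ↥(cmBorelTriple L 3 v).M)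
    (C₂ : Subgroup ↥(cmBorelTriple L 2 v).M) (hC₂o : IsOpen (C₂ : Set ↥(cmBorelTriple L 2 v).M)) (hC₂c : IsCompact (C₂ : Set ↥(cmBorelTriple L 2 v).M))
    (K₁ : Subgroup ((cmDatum L 1 (Matrix.of fun i j : Fin 1 => if i.val + j.val + 1 = 1 then (1 : L) else 0)).Local v)) (hK₁o : IsOpen (K₁ : Set ((cmDatum L 1 (Matrix.of fun i j : Fin 1 => if i.val + j.val + 1 = 1 then (1 : L) else 0)).Local v))) (hK₁c : IsCompact (K₁ : Set ((cmDatum L 1 (Matrix.of fun i j : Fin 1 => if i.val + j.val + 1 = 1 then (1 : L) else 0)).Local v)))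
    (F : Finset (↥(cmBorelTriple L 2 v).M × ((cmDatum L 1 (Matrix.of fun i j : Fin 1 => if i.val + j.val + 1 = 1 then (1 : L) else 0)).Local v)))
    (hcover : (fun x : (↥(cmBorelTriple L 2 v).M × ((cmDatum L 1 (Matrix.of fun i j : Fin 1 => if i.val + j.val + 1 = 1 then (1 : L) else 0)).Local v)) => endoEmbLocal L v ((x.1 : ↥(unitaryGroupOfForm (conjLocal L (IsCMField.complexConj L) v) (cmLocalForm L 2 v))), x.2)) ⁻¹' (Subtype.val '' (b' • (Sn : Set ↥(cmBorelTriple L 3 v).M))) = ⋃ u ∈ F, u • ((C₂.prod K₁ : Subgroup (↥(cmBorelTriple L 2 v).M × ((cmDatum L 1 (Matrix.of fun i j : Fin 1 => if i.val + j.val + 1 = 1 then (1 : L) else 0)).Local v))) : Set (↥(cmBorelTriple L 2 v).M × ((cmDatum L 1 (Matrix.of fun i j : Fin 1 => if i.val + j.val + 1 = 1 then (1 : L) else 0)).Local v))))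
    (hdisj : (↑F : Set (↥(cmBorelTriple L 2 v).M × ((cmDatum L 1 (Matrix.of fun i j : Fin 1 => if i.val + j.val + 1 = 1 then (1 : L) else 0)).Local v))).PairwiseDisjoint (fun u => u • ((C₂.prod K₁ : Subgroup (↥(cmBorelTriple L 2 v).M × ((cmDatum L 1 (Matrix.of fun i j : Fin 1 => if i.val + j.val + 1 = 1 then (1 : L) else 0)).Local v))) : Set (↥(cmBorelTriple L 2 v).M × ((cmDatum L 1 (Matrix.of fun i j : Fin 1 => if i.val + j.val + 1 = 1 then (1 : L) else 0)).Local v))))) :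
    (F.card : ℂ) * (((μT.real {t : ↥(cmBorelTriple L 3 v).M | (t : ↥(unitaryGroupOfForm (conjLocal L (IsCMField.complexConj L) v) (cmLocalForm L 3 v))) ∈ cmLocalIntegralLevel L 3 (Matrix.of fun i j : Fin 3 => if i.val + j.val + 1 = 3 then (1 : L) else 0) v} : ℝ) : ℂ) / ((μT.real (Sn : Set ↥(cmBorelTriple L 3 v).M) : ℝ) : ℂ)) =
      ((ν₁.real Set.univ : ℝ) : ℂ) * ((μT₂.real {t : ↥(cmBorelTriple L 2 v).M | (t : ↥(unitaryGroupOfForm (conjLocal L (IsCMField.complexConj L) v) (cmLocalForm L 2 v))) ∈ cmLocalIntegralLevel L 2 (Matrix.of fun i j : Fin 2 => if i.val + j.val + 1 = 2 then (1 : L) else 0) v} : ℝ) : ℂ) /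
        (((ν₁.real (K₁ : Set ((cmDatum L 1 (Matrix.of fun i j : Fin 1 => if i.val + j.val + 1 = 1 then (1 : L) else 0)).Local v)) : ℝ) : ℂ) * ((μT₂.real (C₂ : Set ↥(cmBorelTriple L 2 v).M) : ℝ) : ℂ)) :=
  hcard_of_unitSet L v Ψ hΨ μT μT₂ ν₁ Sn hSnc hSno b' C₂ hC₂o hC₂c K₁ hK₁o hK₁c F hcover hdisj (preimage_torusIso_unitSet L v w hw Ψ hΨ)

set_option maxHeartbeats 4000000 in  -- cross-spelling `whnf` (as above)
set_option synthInstance.maxHeartbeats 400000 in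
/-- **`hrH : rH ≠ 0`** — the `hrH` binder of ★ p850018 in the letters of record, at a NON-SPLIT place, no unit-set hypothesis. [cite: HewittRoss1979, (15.8)]
[cite: Rogawski1990, §12.7 L. 12.7.3 (proof) p. 195] -/
theorem hrH (w : PlacesOver L v) (hw : IsCMField.complexConj L • w.1 = w.1)
    [MeasurableSpace ↥(unitaryGroupOfForm (conjLocal L (IsCMField.complexConj L) v) (cmLocalForm L 2 v))] [BorelSpace ↥(unitaryGroupOfForm (conjLocal L (IsCMField.complexConj L) v) (cmLocalForm L 2 v))] [MeasurableSpace ((cmDatum L 1 (Matrix.of fun i j : Fin 1 => if i.val + j.val + 1 = 1 then (1 : L) else 0)).Local v)] [BorelSpace ((cmDatum L 1 (Matrix.of fun i j : Fin 1 => if i.val + j.val + 1 = 1 then (1 : L) else 0)).Local v)] [MeasurableSpace ↥(unitaryGroupOfForm (conjLocal L (IsCMField.complexConj L) v) (cmLocalForm L 3 v))] [BorelSpace ↥(unitaryGroupOfForm (conjLocal L (IsCMField.complexConj L) v) (cmLocalForm L 3 v))]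
    (Ψ : (↥(cmBorelTriple L 2 v).M × ((cmDatum L 1 (Matrix.of fun i j : Fin 1 => if i.val + j.val + 1 = 1 then (1 : L) else 0)).Local v)) ≃ₜ* ↥(cmBorelTriple L 3 v).M)
    (hΨ : ∀ x : (↥(cmBorelTriple L 2 v).M × ((cmDatum L 1 (Matrix.of fun i j : Fin 1 => if i.val + j.val + 1 = 1 then (1 : L) else 0)).Local v)), (((Ψ x : ↥(cmBorelTriple L 3 v).M)) : ↥(unitaryGroupOfForm (conjLocal L (IsCMField.complexConj L) v) (cmLocalForm L 3 v))) = endoEmbLocal L v ((x.1 : ↥(unitaryGroupOfForm (conjLocal L (IsCMField.complexConj L) v) (cmLocalForm L 2 v))), x.2))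
    (μT₂ : Measure ↥(cmBorelTriple L 2 v).M) [μT₂.IsHaarMeasure] (ν₁ : Measure ((cmDatum L 1 (Matrix.of fun i j : Fin 1 => if i.val + j.val + 1 = 1 then (1 : L) else 0)).Local v)) [ν₁.IsHaarMeasure]
    (C₂ : Subgroup ↥(cmBorelTriple L 2 v).M) (hC₂o : IsOpen (C₂ : Set ↥(cmBorelTriple L 2 v).M)) (hC₂c : IsCompact (C₂ : Set ↥(cmBorelTriple L 2 v).M))
    (K₁ : Subgroup ((cmDatum L 1 (Matrix.of fun i j : Fin 1 => if i.val + j.val + 1 = 1 then (1 : L) else 0)).Local v)) (hK₁o : IsOpen (K₁ : Set ((cmDatum L 1 (Matrix.of fun i j : Fin 1 => if i.val + j.val + 1 = 1 then (1 : L) else 0)).Local v))) (hK₁c : IsCompact (K₁ : Set ((cmDatum L 1 (Matrix.of fun i j : Fin 1 => if i.val + j.val + 1 = 1 then (1 : L) else 0)).Local v))) :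
    ((ν₁.real Set.univ : ℝ) : ℂ) * ((μT₂.real {t : ↥(cmBorelTriple L 2 v).M | (t : ↥(unitaryGroupOfForm (conjLocal L (IsCMField.complexConj L) v) (cmLocalForm L 2 v))) ∈ cmLocalIntegralLevel L 2 (Matrix.of fun i j : Fin 2 => if i.val + j.val + 1 = 2 then (1 : L) else 0) v} : ℝ) : ℂ) /
        (((ν₁.real (K₁ : Set ((cmDatum L 1 (Matrix.of fun i j : Fin 1 => if i.val + j.val + 1 = 1 then (1 : L) else 0)).Local v)) : ℝ) : ℂ) * ((μT₂.real (C₂ : Set ↥(cmBorelTriple L 2 v).M) : ℝ) : ℂ)) ≠ 0 :=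
  hrH_of_unitSet L v Ψ μT₂ ν₁ C₂ hC₂o hC₂c K₁ hK₁o hK₁c (preimage_torusIso_unitSet L v w hw Ψ hΨ)

end Heads

end Summit.HodgeConjecture.HodgeConjecture.Cruxes.H413.F0P3cStCharTSHcard

end
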